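import Mathlib

/-!
# ConjDualConductorParity — at a ramified place (`p` odd) a conjugate-dual character has even conductor or conductor `≤ 1`

Blind re-derivation cell `pub-hodge-repro`, seat night-2 (gen 6).  Target tree path
`lean/Summits/Ventures/HodgeRepro/ConjDualConductorParity.lean`.  Gen 5 proved on the ring `R8 = 𝒪/𝔭⁸` of the
ramified places `𝔭 | 5` of the octic point `E = ℚ(ζ₅, √(4 + √5))` that no conjugate-dual character has conductor
`3`, `5` or `7` (`OcticCMPointEightOddConductor.conjDual_conductor_ne_odd`).  Here the argument is freed from the
model: it is a statement about ANY commutative ring `R` with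

* a ring endomorphism `σ` (the conjugation of `K_v / k_v`) and an element `ϖ` (the uniformiser) with
  `σ ϖ = −ϖ` (`ϖ` is `σ`-odd: `K_v / k_v` ramified, `p` odd),
* `σ x ≡ x` modulo `ϖ` for every `x` (`σ` induces the identity on the residue field — `K_v / k_v` ramified),
* `2` a unit (`p` odd) and `ϖ` nilpotent (`R` is a quotient `𝒪/𝔭^c`).

**The theorem** (`ConjDual.trivialOn_even_of_odd`).  For a multiplicative character `ρ` of `R` with
`ρ ∘ σ = ρ⁻¹` (conjugate-dual, `ConjDual σ ρ`), if `ρ` is trivial on `1 + ϖ^{2m+1} R` (`m ≥ 1`) then it is trivial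
on `1 + ϖ^{2m} R`: with `h = 2⁻¹`, `v = 1 + h ϖ^{2m} s` and `σ s = s + ϖ y`,

`v · σ(v) = 1 + h ϖ^{2m}(s + σ s) + h² ϖ^{4m} s σ(s) = (1 + ϖ^{2m} s) + ϖ^{2m+1} z`,

so `1 + ϖ^{2m} s` is the norm `v σ(v)` times a unit `≡ 1` modulo `ϖ^{2m+1}`, and a conjugate-dual character is
trivial on norms (`ConjDual.norm`: `ρ(v σ v) = ρ(v) ρ(v)⁻¹ = 1`).  Consequently (`ConjDual.conductor_even_or_le_one`)
**the conductor of a conjugate-dual character — the least `c` with `ρ` trivial on `1 + ϖ^c R` — is even or `≤ 1`.**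

This is the norm computation behind local class field theory for the ramified quadratic extension (`N(1 + 𝔭_K^{2m})
⊇ 1 + 𝔭_k^{m}` modulo the next step): the odd rows of the root-number table at `𝔭 | 5` are EMPTY for every conductor,
not only for `c ≤ 8` (`OcticCMPointRamifiedTower.lean` instantiates this on `𝒪/𝔭^{4k}` for every `k`).  No printed
statement is transcribed here; everything is a ring identity.

**What this is not.**  Nothing is said about the inert place `𝔮 | 2` (there `σ` is NOT the identity on the residue
field and odd conductors occur — gen 5's `numerics/conjdual_exists.py`), about the even conductors' root numbers,
or about the status of the Hodge conjecture for CM abelian varieties, which is NOT proved.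
-/

set_option autoImplicit false

noncomputable section

open Classical

namespace Summit.Ventures.HodgeRepro.ConductorParity

variable {R : Type} [CommRing R]

/-! ### Triviality on `1 + ϖ^c R` and the conductor -/

/-- **`ρ` is trivial on `1 + ϖ^c R`** (the conductor of `ρ` divides `𝔭^c`). -/
def TrivialOn (ρ : MulChar R ℂ) (ϖ : R) (c : ℕ) : Prop := ∀ y : R, ρ (1 + ϖ ^ c * y) = 1

/-- Triviality on `1 + ϖ^c R` passes to `1 + ϖ^{c+1} R`. -/
theorem TrivialOn.succ {ρ : MulChar R ℂ} {ϖ : R} {c : ℕ} (h : TrivialOn ρ ϖ c) : TrivialOn ρ ϖ (c + 1) := by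
  intro y
  have := h (ϖ * y)
  rwa [pow_succ, mul_assoc]

/-- Triviality on `1 + ϖ^c R` passes to every `1 + ϖ^d R`, `d ≥ c`. -/
theorem TrivialOn.mono {ρ : MulChar R ℂ} {ϖ : R} {c d : ℕ} (h : TrivialOn ρ ϖ c) (hcd : c ≤ d) :
    TrivialOn ρ ϖ d :=
  Nat.le_induction h (fun _ _ ih => ih.succ) d hcd

/-- If `ϖ^N = 0` then every character is trivial on `1 + ϖ^N R = {1}`. -/
theorem trivialOn_of_pow_eq_zero (ρ : MulChar R ℂ) {ϖ : R} {N : ℕ} (hN : ϖ ^ N = 0) : TrivialOn ρ ϖ N := by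
  intro y
  rw [hN, zero_mul, add_zero, map_one]

/-- **The conductor** of `ρ` with respect to `ϖ`: the least `c` with `ρ` trivial on `1 + ϖ^c R` (given that some
`c` works — e.g. `ϖ` nilpotent). -/
def conductor (ρ : MulChar R ℂ) (ϖ : R) (hex : ∃ c, TrivialOn ρ ϖ c) : ℕ := Nat.find hex

/-- `ρ` is trivial on `1 + ϖ^{conductor} R`. -/
theorem trivialOn_conductor (ρ : MulChar R ℂ) (ϖ : R) (hex : ∃ c, TrivialOn ρ ϖ c) :
    TrivialOn ρ ϖ (conductor ρ ϖ hex) :=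
  Nat.find_spec hex

/-- The conductor is at most any `c` on which `ρ` is trivial. -/
theorem conductor_le (ρ : MulChar R ℂ) (ϖ : R) (hex : ∃ c, TrivialOn ρ ϖ c) {c : ℕ} (h : TrivialOn ρ ϖ c) :
    conductor ρ ϖ hex ≤ c :=
  Nat.find_min' hex h

/-- Below the conductor `ρ` is not trivial. -/
theorem not_trivialOn_of_lt_conductor (ρ : MulChar R ℂ) (ϖ : R) (hex : ∃ c, TrivialOn ρ ϖ c) {c : ℕ}
    (h : c < conductor ρ ϖ hex) : ¬ TrivialOn ρ ϖ c := by
  unfold conductor at h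
  exact Nat.find_min hex h

/-! ### Conjugate duality and norms -/

/-- **Conjugate duality**: `ρ ∘ σ = ρ⁻¹` (the local condition on the characters of the face's four lines at a
non-split place: `ρ(σ x) = ρ(x)⁻¹` on the units). -/
def ConjDual (σ : R →+* R) (ρ : MulChar R ℂ) : Prop := ∀ x, ρ (σ x) = ρ⁻¹ x

/-- A conjugate-dual character is trivial on the norms `v σ(v)` of units. -/
theorem ConjDual.norm {σ : R →+* R} {ρ : MulChar R ℂ} (hσ : ConjDual σ ρ) (v : Rˣ) :
    ρ ((v : R) * σ v) = 1 := by
  rw [map_mul, hσ, MulChar.inv_apply_eq_inv']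
  have h1 : ρ (v : R) * ρ ((v⁻¹ : Rˣ) : R) = 1 := by rw [← map_mul, Units.mul_inv, map_one]
  exact mul_inv_cancel₀ (left_ne_zero_of_mul_eq_one h1)

/-- `σ` fixes the inverse of `2` (it fixes `2`). -/
theorem map_half_eq {σ : R →+* R} {h : R} (hh : 2 * h = 1) : σ h = h := by
  have h2 : (2 : R) * σ h = 1 := by
    have := congrArg σ hh
    rwa [map_mul, map_ofNat, map_one] at this
  calc σ h = (2 * h) * σ h := by rw [hh, one_mul]
    _ = h * (2 * σ h) := by ring
    _ = h := by rw [h2, mul_one]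

/-- `1 + ϖ x` is a unit when `ϖ` is nilpotent. -/
theorem isUnit_one_add_mul_of_isNilpotent {ϖ : R} (hnil : IsNilpotent ϖ) (x : R) : IsUnit (1 + ϖ * x) :=
  ((Commute.all ϖ x).isNilpotent_mul_right hnil).isUnit_one_add

/-! ### The parity theorem -/

/-- **The norm identity**: with `2 h = 1`, `σ ϖ = −ϖ`, `σ s = s + ϖ y` and `v = 1 + h ϖ^{2m+2} s`,
`v · σ(v) = (1 + ϖ^{2m+2} s) + ϖ^{2m+3} · (h y + h² ϖ^{2m+1} s σ(s))`. -/
theorem norm_one_add_half_mul (σ : R →+* R) (ϖ : R) (hσϖ : σ ϖ = -ϖ) {h : R} (hh : 2 * h = 1) (m : ℕ)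
    (s y : R) (hy : σ s - s = ϖ * y) :
    (1 + h * ϖ ^ (2 * m + 2) * s) * σ (1 + h * ϖ ^ (2 * m + 2) * s) =
      (1 + ϖ ^ (2 * m + 2) * s) + ϖ ^ (2 * m + 3) * (h * y + h ^ 2 * ϖ ^ (2 * m + 1) * s * σ s) := by
  have hσh : σ h = h := map_half_eq hh
  have hpow : σ (ϖ ^ (2 * m + 2)) = ϖ ^ (2 * m + 2) := by
    rw [map_pow, hσϖ, Even.neg_pow ⟨m + 1, by ring⟩]
  rw [map_add, map_one, map_mul, map_mul, hσh, hpow]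
  linear_combination (ϖ ^ (2 * m + 2) * s) * hh + (h * ϖ ^ (2 * m + 2)) * hy

/-- **A conjugate-dual character trivial on `1 + ϖ^{2m+3} R` is trivial on `1 + ϖ^{2m+2} R`** (`p` odd, `K_v / k_v`
ramified): `1 + ϖ^{2m+2} s` is a norm times a unit `≡ 1` modulo `ϖ^{2m+3}`. -/
theorem ConjDual.trivialOn_of_succ (σ : R →+* R) (ϖ : R) (hσϖ : σ ϖ = -ϖ) (hres : ∀ x, ∃ y, σ x - x = ϖ * y)
    (h2 : IsUnit (2 : R)) (hnil : IsNilpotent ϖ) {ρ : MulChar R ℂ} (hσ : ConjDual σ ρ) (m : ℕ)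
    (h : TrivialOn ρ ϖ (2 * m + 3)) : TrivialOn ρ ϖ (2 * m + 2) := by
  intro s
  obtain ⟨hf, hhf⟩ := h2.exists_right_inv
  obtain ⟨y, hy⟩ := hres s
  set v : R := 1 + hf * ϖ ^ (2 * m + 2) * s with hv
  set u : R := 1 + ϖ ^ (2 * m + 2) * s with hu
  set z : R := hf * y + hf ^ 2 * ϖ ^ (2 * m + 1) * s * σ s with hz
  have hN : v * σ v = u + ϖ ^ (2 * m + 3) * z := norm_one_add_half_mul σ ϖ hσϖ hhf m s y hy
  -- `u` is a unit: `1 + ϖ · (ϖ^{2m+1} s)`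
  have hu_unit : IsUnit u := by
    have := isUnit_one_add_mul_of_isNilpotent hnil (ϖ ^ (2 * m + 1) * s)
    rwa [hu, show ϖ ^ (2 * m + 2) * s = ϖ * (ϖ ^ (2 * m + 1) * s) by ring]
  obtain ⟨ui, hui⟩ := hu_unit.exists_right_inv
  -- `v` is a unit: `1 + ϖ · (hf ϖ^{2m+1} s)`
  have hv_unit : IsUnit v := by
    have := isUnit_one_add_mul_of_isNilpotent hnil (hf * ϖ ^ (2 * m + 1) * s)
    rwa [hv, show hf * ϖ ^ (2 * m + 2) * s = ϖ * (hf * ϖ ^ (2 * m + 1) * s) by ring]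
  have hfac : u * (1 + ϖ ^ (2 * m + 3) * (ui * z)) = v * σ v := by
    rw [hN]
    linear_combination (ϖ ^ (2 * m + 3) * z) * hui
  calc ρ u = ρ u * ρ (1 + ϖ ^ (2 * m + 3) * (ui * z)) := by rw [h (ui * z), mul_one]
    _ = ρ (u * (1 + ϖ ^ (2 * m + 3) * (ui * z))) := by rw [map_mul]
    _ = ρ ((hv_unit.unit : R) * σ hv_unit.unit) := by rw [hfac, IsUnit.unit_spec]
    _ = 1 := hσ.norm _

/-- **The parity theorem**: a conjugate-dual character trivial on `1 + ϖ^{2m+1} R`, `m ≥ 1`, is trivial on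
`1 + ϖ^{2m} R`. -/
theorem ConjDual.trivialOn_even_of_odd (σ : R →+* R) (ϖ : R) (hσϖ : σ ϖ = -ϖ)
    (hres : ∀ x, ∃ y, σ x - x = ϖ * y) (h2 : IsUnit (2 : R)) (hnil : IsNilpotent ϖ) {ρ : MulChar R ℂ}
    (hσ : ConjDual σ ρ) {m : ℕ} (hm : 1 ≤ m) (h : TrivialOn ρ ϖ (2 * m + 1)) : TrivialOn ρ ϖ (2 * m) := by
  obtain ⟨m', rfl⟩ : ∃ m', m = m' + 1 := ⟨m - 1, by omega⟩
  have h' : TrivialOn ρ ϖ (2 * m' + 3) := by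
    have : 2 * (m' + 1) + 1 = 2 * m' + 3 := by ring
    rwa [this] at h
  have := ConjDual.trivialOn_of_succ σ ϖ hσϖ hres h2 hnil hσ m' h'
  rwa [show 2 * (m' + 1) = 2 * m' + 2 by ring]

/-- **The conductor of a conjugate-dual character is even or `≤ 1`** (`p` odd, `K_v / k_v` ramified): an odd
conductor `2m + 1 ≥ 3` would contradict minimality by `trivialOn_even_of_odd`. -/
theorem ConjDual.conductor_even_or_le_one (σ : R →+* R) (ϖ : R) (hσϖ : σ ϖ = -ϖ)
    (hres : ∀ x, ∃ y, σ x - x = ϖ * y) (h2 : IsUnit (2 : R)) (hnil : IsNilpotent ϖ) {ρ : MulChar R ℂ}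
    (hσ : ConjDual σ ρ) (hex : ∃ c, TrivialOn ρ ϖ c) :
    conductor ρ ϖ hex ≤ 1 ∨ Even (conductor ρ ϖ hex) := by
  rcases Nat.even_or_odd (conductor ρ ϖ hex) with he | ho
  · exact Or.inr he
  left
  by_contra h1
  obtain ⟨m, hm⟩ := ho
  have hm1 : 1 ≤ m := by omega
  have htriv : TrivialOn ρ ϖ (2 * m + 1) := by
    rw [← hm]
    exact trivialOn_conductor ρ ϖ hex
  have hev : TrivialOn ρ ϖ (2 * m) := ConjDual.trivialOn_even_of_odd σ ϖ hσϖ hres h2 hnil hσ hm1 htriv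
  have := conductor_le ρ ϖ hex hev
  omega

/-- The conductor of a conjugate-dual character is never an odd number `≥ 3`. -/
theorem ConjDual.conductor_ne_odd (σ : R →+* R) (ϖ : R) (hσϖ : σ ϖ = -ϖ)
    (hres : ∀ x, ∃ y, σ x - x = ϖ * y) (h2 : IsUnit (2 : R)) (hnil : IsNilpotent ϖ) {ρ : MulChar R ℂ}
    (hσ : ConjDual σ ρ) (hex : ∃ c, TrivialOn ρ ϖ c) (m : ℕ) (hm : 1 ≤ m) :
    conductor ρ ϖ hex ≠ 2 * m + 1 := by
  intro hc
  rcases ConjDual.conductor_even_or_le_one σ ϖ hσϖ hres h2 hnil hσ hex with h | h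
  · omega
  · rw [hc] at h
    exact (Nat.not_even_iff_odd.mpr ⟨m, rfl⟩) h

end Summit.Ventures.HodgeRepro.ConductorParity

end
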